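import Literature.NumberTheory.Automorphic.UnitaryDualPairDoubledLineAdelicAction
import Literature.NumberTheory.Automorphic.DoubledUnitaryBorelWeylFactorisation
import HarnessLib

/-!
# The Borel of `U(1,1)_{E/F}` in the diagonal model: unipotent radical, its action on `𝕎 ⊕ 𝕎⁻`, and the RED-B factorisation

Topic `NumberTheory/Automorphic`; namespaces `Literature.NumberTheory.Automorphic.DoubledUnitary.RankOneReduction` (§1–§2) and
`Literature.NumberTheory.Automorphic.UnitaryGroup` (§3).  KERNEL only: proved theorems, no definition, no named fact.
Sequel of ★ `DoubledUnitaryRankOneReductionDiag` (Cayley matrix `M = !![1, h; 1, −h]`, `h(t+t) = 1`),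
★ `DoubledUnitaryBorelWeylFactorisation` (`n(x) = !![1, x; 0, 1]` pinned GL-elements, `n(x) ∈ U(τ,J₁) ↔ τ x + x = 0`) and
★ `UnitaryDualPairDoubledLineAdelicAction` (`ι_{eD}(1 ⊗ A)` acts by the `E`-scalar matrix `(re A, im A)`).

* §1 (any commutative ring): **`coe_cayley_conj_upper`** — `M · n(x) · M⁻¹ = !![1 + x t, −x t; x t, 1 − x t]` (`= 1 + x t · !![1,−1;1,−1]`,
  the unipotent radical of the stabiliser of `W^Δ = (1,1)` in the diagonal model `!![t,0;0,−t]`), and its row sums (`rowSum_cayley_conj_upper`);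
* §2 (adeles of the quadratic `E/F`): `cayley_conj_upper_mem_adelic` — for `x = δ · y` (`y ∈ 𝔸_F`) the element `M n(x) M⁻¹` lies in
  `U_D = UnitaryGroup.adelic F E c (1+1) (T_W ⊕ −T_W)`;
* §3 **`toSp_adelicInr_cayley_conj_upper_apply`** — `ι_{eD}(1 ⊗ M n(δ y) M⁻¹)` acts on `(w₁, w₂) ∈ 𝕎 ⊕ 𝕎⁻`, `w_j = (x_j, y_j)`, by
  `x_j ↦ x_j + (d b)·(y₁ − y₂)`, `y_j ↦ y_j + b·(x₁ − x₂)` with `b = y · t` (`t = T_W 0 0`): it fixes `W^Δ` pointwise and translates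
  `W^∇ → W^Δ` by the trace-zero scalar `b δ` — the vector hypothesis `hN` of the doubled-frame Borel law (L-N);
* §4 **`exists_borel_factorisation_diag`** — ★ `exists_borel_factorisation` (RED-B: `b = d(q)n(δξ)·n(δω)·d(c·z r)`) TRANSPORTED to the
  diagonal carrier `U_D` along the Cayley matrix `M` (Borel = stabiliser of `W^Δ`, `b₀₀ + b₀₁ = b₁₀ + b₁₁`), with the rational factor
  `γ = M(d(q)n(δξ))M⁻¹` exhibited as an `E`-rational matrix (`upper_mem_range_map`, ★ `diag_principal_eq_map`).

References: M. Harris, S. Kudla, W. Sweet, J. AMS 9 (1996), §1 (1.11); S. Gelbart, J. Rogawski, Invent. Math. 105 (1991), §1, §3.1;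
A. Weil, *Sur la formule de Siegel…*, Acta Math. 113 (1965), n° 50.

Written for the Hodge-CM cell `pub/hodgecm-mathlib`, floor 0, crux H413 (stmt-HodgeConjecture-24833), E-2 child line `F0_E2SiegelWeilWeilRange`,
SW2c-BOUND sheet v1 rows (RED-B)/(L-N) (A-p16 (g18), 2026-08-31).  HC_CM is proved only modulo the printed citations until rung 0 closes;
this file discharges none of them.
-/

set_option autoImplicit false

noncomputable section

open scoped Kronecker Matrix NNReal MatrixGroups
open NumberField
open Literature.RepresentationTheory.HeisenbergGroup
open Literature.NumberTheory.Weil1964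

namespace Literature.NumberTheory.Automorphic

namespace DoubledUnitary.RankOneReduction

/-! ## §1 `M · n(x) · M⁻¹` over a commutative ring -/

section Generic

variable {S : Type*} [CommRing S] {M nx : GL (Fin 2) S} {t h x : S}

/-- **The unipotent radical in the diagonal model**: `M · n(x) · M⁻¹ = !![1 + x t, −x t; x t, 1 − x t]` for the Cayley matrix
`M = !![1, h; 1, −h]` (`h(t+t) = 1`) and `n(x) = !![1, x; 0, 1]`. [cite: HarrisKudlaSweet1996, §1 (1.11)] -/
theorem coe_cayley_conj_upper (hM : (M : Matrix (Fin 2) (Fin 2) S) = !![1, h; 1, -h]) (hht : h * (t + t) = 1)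
    (hn : (nx : Matrix (Fin 2) (Fin 2) S) = !![1, x; 0, 1]) :
    ((M * nx * M⁻¹ : GL (Fin 2) S) : Matrix (Fin 2) (Fin 2) S) = !![1 + x * t, -(x * t); x * t, 1 - x * t] := by
  rw [Units.val_mul, Units.val_mul, coe_inv_cayleyTwo hM hht, hM, hn]
  ext i j
  fin_cases i <;> fin_cases j <;> simp [Matrix.mul_apply, Fin.sum_univ_two] <;> first | linear_combination hht | ring1

/-- The row sums of `M · n(x) · M⁻¹` agree (it stabilises `W^Δ = (1,1)`; both equal `1`). [cite: HarrisKudlaSweet1996, §1 (1.11)] -/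
theorem rowSum_cayley_conj_upper (hM : (M : Matrix (Fin 2) (Fin 2) S) = !![1, h; 1, -h]) (hht : h * (t + t) = 1)
    (hn : (nx : Matrix (Fin 2) (Fin 2) S) = !![1, x; 0, 1]) :
    ((M * nx * M⁻¹ : GL (Fin 2) S) : Matrix (Fin 2) (Fin 2) S) 0 0 + ((M * nx * M⁻¹ : GL (Fin 2) S) : Matrix (Fin 2) (Fin 2) S) 0 1 =
      ((M * nx * M⁻¹ : GL (Fin 2) S) : Matrix (Fin 2) (Fin 2) S) 1 0 + ((M * nx * M⁻¹ : GL (Fin 2) S) : Matrix (Fin 2) (Fin 2) S) 1 1 := by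
  rw [coe_cayley_conj_upper hM hht hn]
  simp

end Generic

/-! ## §2 Over the adeles: `M · n(δ·y) · M⁻¹ ∈ U_D` -/

section Adelic

variable (F E : Type) [Field F] [NumberField F] [Field E] [NumberField E] [Algebra F E] (c : E ≃ₐ[F] E)
  (TW : Matrix (Fin 1) (Fin 1) F)

/-- **`M · n(x) · M⁻¹ ∈ U_D = U(c ⊗ 1, T_W ⊕ −T_W)(𝔸_F)` whenever `c̄x + x = 0`** (e.g. `x = δ · f(y)`, `y ∈ 𝔸_F`).
[cite: GelbartRogawski1991, §1] -/
theorem cayley_conj_upper_mem_adelic (hTW : TW 0 0 ≠ 0) {M : GL (Fin 2) (AdeleRing (𝓞 E) E)}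
    (hM : (M : Matrix (Fin 2) (Fin 2) (AdeleRing (𝓞 E) E)) =
      !![1, algebraMap E (AdeleRing (𝓞 E) E) (algebraMap F E (2 * TW 0 0)⁻¹);
        1, -algebraMap E (AdeleRing (𝓞 E) E) (algebraMap F E (2 * TW 0 0)⁻¹)])
    {nx : GL (Fin 2) (AdeleRing (𝓞 E) E)} {x : AdeleRing (𝓞 E) E}
    (hn : (nx : Matrix (Fin 2) (Fin 2) (AdeleRing (𝓞 E) E)) = !![1, x; 0, 1])
    (hx : UnitaryGroup.conjAdele F E c x + x = 0) :
    M * nx * M⁻¹ ∈ UnitaryGroup.adelic F E c (1 + 1)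
      ((Matrix.reindex finSumFinEquiv finSumFinEquiv (Matrix.fromBlocks TW 0 0 (-TW))).map (algebraMap F E)) :=
  (conj_mem_adelic_doubledLine_iff F E c TW hTW hM _).2 ((upper_mem_iff (UnitaryGroup.conjAdele F E c) hn).2 hx)

/-- `c̄(δ · f y) + δ · f y = 0` for `y ∈ 𝔸_F` (`c̄δ = −δ`, `c̄` fixes `𝔸_F`). [cite: GelbartRogawski1991, §1] -/
theorem conjAdele_delta_mul_baseChange_add (δ : E) (hcδ : c δ = -δ) (y : AdeleRing (𝓞 F) F) :
    UnitaryGroup.conjAdele F E c (algebraMap E (AdeleRing (𝓞 E) E) δ * AdeleRing.baseChange F E y) +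
      algebraMap E (AdeleRing (𝓞 E) E) δ * AdeleRing.baseChange F E y = 0 := by
  rw [map_mul, conjAdele_algebraMap_eq_neg F E c δ hcδ, UnitaryGroup.conjAdele_apply, AdeleRing.smul_baseChange, neg_mul,
    neg_add_cancel]

end Adelic

end DoubledUnitary.RankOneReduction

/-! ## §3 The action of `ι_{eD}(1 ⊗ M n(δy) M⁻¹)` on `𝕎 ⊕ 𝕎⁻` -/

namespace UnitaryGroup

section Action

variable (F E : Type) [Field F] [NumberField F] [Field E] [NumberField E] [Algebra F E] [Algebra.IsQuadraticExtension F E]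
  (c : E ≃ₐ[F] E) {δ : E} (hcδ : c δ = -δ) (hδ : δ ≠ 0) {d : F} (hd : δ * δ = algebraMap F E d)
  (N : ℕ) {n : ℕ} (e : Fin N × Fin 1 ≃ Fin n)
  {TV : Matrix (Fin N) (Fin N) F} (TW : Matrix (Fin 1) (Fin 1) F) (hV : TV.IsSymm)
  (hW2 : (Matrix.reindex finSumFinEquiv finSumFinEquiv (Matrix.fromBlocks TW 0 0 (-TW))).IsSymm)

/-- **`ι_{eD}(1 ⊗ M·n(δ y)·M⁻¹)` fixes `W^Δ` and translates `W^∇ → W^Δ` by the trace-zero scalar `b δ`, `b = y · t`**: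
on `(w₁, w₂)`, `w_j = (x_j, y_j)`: `x_j ↦ x_j + (d b)·(y₁ − y₂)`, `y_j ↦ y_j + b·(x₁ − x₂)` (the vector hypothesis `hN` of the
geometric-frame Borel law (L-N)). [cite: HarrisKudlaSweet1996, §1 (1.11)] [cite: GelbartRogawski1991, §3.1 p. 454] -/
theorem toSp_adelicInr_cayley_conj_upper_apply (hTW : TW 0 0 ≠ 0) {M : GL (Fin 2) (AdeleRing (𝓞 E) E)}
    (hM : (M : Matrix (Fin 2) (Fin 2) (AdeleRing (𝓞 E) E)) =
      !![1, algebraMap E (AdeleRing (𝓞 E) E) (algebraMap F E (2 * TW 0 0)⁻¹);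
        1, -algebraMap E (AdeleRing (𝓞 E) E) (algebraMap F E (2 * TW 0 0)⁻¹)])
    {nx : GL (Fin 2) (AdeleRing (𝓞 E) E)} (y : AdeleRing (𝓞 F) F)
    (hn : (nx : Matrix (Fin 2) (Fin 2) (AdeleRing (𝓞 E) E)) = !![1, algebraMap E (AdeleRing (𝓞 E) E) δ * AdeleRing.baseChange F E y; 0, 1])
    (hA : M * nx * M⁻¹ ∈
      adelic F E c (1 + 1) ((Matrix.reindex finSumFinEquiv finSumFinEquiv (Matrix.fromBlocks TW 0 0 (-TW))).map (algebraMap F E)))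
    (x₁ x₂ y₁ y₂ : Fin n → AdeleRing (𝓞 F) F) :
    ((GelbartRogawski1991.UnitaryDualPair.toSp F E c N (1 + 1)
          (((Equiv.prodCongr (Equiv.refl (Fin N)) finSumFinEquiv.symm).trans (Equiv.prodSumDistrib (Fin N) (Fin 1) (Fin 1))).trans
            ((Equiv.sumCongr e e).trans finSumFinEquiv))
          (TV.map (algebraMap F E)) ((Matrix.reindex finSumFinEquiv finSumFinEquiv (Matrix.fromBlocks TW 0 0 (-TW))).map (algebraMap F E))
          hcδ hδ hd hV hW2 rfl rfl
          (adelicInr F E c N (1 + 1) (TV.map (algebraMap F E))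
            ((Matrix.reindex finSumFinEquiv finSumFinEquiv (Matrix.fromBlocks TW 0 0 (-TW))).map (algebraMap F E))
            ⟨M * nx * M⁻¹, hA⟩) :
          symplecticGroup (polar (Weil1964.adelicForm F (Fin (n + n))
            (GelbartRogawski1991.UnitaryDualPair.adelicGram F
              (((Equiv.prodCongr (Equiv.refl (Fin N)) finSumFinEquiv.symm).trans (Equiv.prodSumDistrib (Fin N) (Fin 1) (Fin 1))).trans
                ((Equiv.sumCongr e e).trans finSumFinEquiv)) TV
              (Matrix.reindex finSumFinEquiv finSumFinEquiv (Matrix.fromBlocks TW 0 0 (-TW))))))) :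
        ((Fin (n + n) → AdeleRing (𝓞 F) F) × (Fin (n + n) → AdeleRing (𝓞 F) F)) ≃ₗ[AdeleRing (𝓞 F) F]
          ((Fin (n + n) → AdeleRing (𝓞 F) F) × (Fin (n + n) → AdeleRing (𝓞 F) F)))
        (reindexW (AdeleRing (𝓞 F) F) (finSumFinEquiv : Fin n ⊕ Fin n ≃ Fin (n + n)) (Sum.elim x₁ x₂, Sum.elim y₁ y₂)) =
      reindexW (AdeleRing (𝓞 F) F) (finSumFinEquiv : Fin n ⊕ Fin n ≃ Fin (n + n))
        (Sum.elim (x₁ + (algebraMap F (AdeleRing (𝓞 F) F) d * (y * algebraMap F (AdeleRing (𝓞 F) F) (TW 0 0))) • (y₁ - y₂))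
            (x₂ + (algebraMap F (AdeleRing (𝓞 F) F) d * (y * algebraMap F (AdeleRing (𝓞 F) F) (TW 0 0))) • (y₁ - y₂)),
          Sum.elim (y₁ + (y * algebraMap F (AdeleRing (𝓞 F) F) (TW 0 0)) • (x₁ - x₂))
            (y₂ + (y * algebraMap F (AdeleRing (𝓞 F) F) (TW 0 0)) • (x₁ - x₂))) := by
  have hq := isQuadraticCoordinates_adele E c hcδ hδ hd
  set bF : AdeleRing (𝓞 F) F := y * algebraMap F (AdeleRing (𝓞 F) F) (TW 0 0) with hbF
  -- the matrix of `M n(x) M⁻¹` and its quadratic coordinates: `x t = δ · f(y t)` has `re = 0`, `im = y t`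
  have hht : algebraMap E (AdeleRing (𝓞 E) E) (algebraMap F E (2 * TW 0 0)⁻¹) *
      (algebraMap E (AdeleRing (𝓞 E) E) (algebraMap F E (TW 0 0)) + algebraMap E (AdeleRing (𝓞 E) E) (algebraMap F E (TW 0 0))) = 1 := by
    rw [← map_add, ← map_add, ← map_mul, ← map_mul, ← two_mul, inv_mul_cancel₀ (mul_ne_zero two_ne_zero hTW), map_one, map_one]
  have hmat := DoubledUnitary.RankOneReduction.coe_cayley_conj_upper hM hht hn
  have hxt : algebraMap E (AdeleRing (𝓞 E) E) δ * AdeleRing.baseChange F E y * algebraMap E (AdeleRing (𝓞 E) E) (algebraMap F E (TW 0 0)) =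
      AdeleRing.baseChange F E 0 + AdeleRing.baseChange F E bF * algebraMap E (AdeleRing (𝓞 E) E) δ := by
    rw [map_zero, zero_add, hbF, map_mul, AdeleRing.baseChange_algebraMap]
    ring
  have hre : QuadraticCoordinates.re (quadraticAdeleEquiv F E c hcδ hδ).toAddEquiv
      (algebraMap E (AdeleRing (𝓞 E) E) δ * AdeleRing.baseChange F E y * algebraMap E (AdeleRing (𝓞 E) E) (algebraMap F E (TW 0 0))) = 0 := by
    rw [hxt]; exact hq.re_eq 0 bF
  have him : QuadraticCoordinates.im (quadraticAdeleEquiv F E c hcδ hδ).toAddEquiv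
      (algebraMap E (AdeleRing (𝓞 E) E) δ * AdeleRing.baseChange F E y * algebraMap E (AdeleRing (𝓞 E) E) (algebraMap F E (TW 0 0))) = bF := by
    rw [hxt]; exact hq.im_eq 0 bF
  have hP : ((M * nx * M⁻¹ : GL (Fin 2) (AdeleRing (𝓞 E) E)) : Matrix (Fin 2) (Fin 2) (AdeleRing (𝓞 E) E)).map
      (QuadraticCoordinates.re (quadraticAdeleEquiv F E c hcδ hδ).toAddEquiv) = !![1, 0; 0, 1] := by
    rw [hmat]
    ext i j
    fin_cases i <;> fin_cases j <;>
      simp only [Matrix.map_apply, Matrix.of_apply, Matrix.cons_val', Matrix.cons_val_zero, Matrix.cons_val_one,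
        Matrix.cons_val_fin_one, Matrix.empty_val', Fin.zero_eta, Fin.mk_one, Fin.isValue, map_add, map_sub, map_neg, hre,
        hq.re_one, add_zero, sub_zero, neg_zero]
  have hQ : ((M * nx * M⁻¹ : GL (Fin 2) (AdeleRing (𝓞 E) E)) : Matrix (Fin 2) (Fin 2) (AdeleRing (𝓞 E) E)).map
      (QuadraticCoordinates.im (quadraticAdeleEquiv F E c hcδ hδ).toAddEquiv) = !![bF, -bF; bF, -bF] := by
    rw [hmat]
    ext i j
    fin_cases i <;> fin_cases j <;>
      simp only [Matrix.map_apply, Matrix.of_apply, Matrix.cons_val', Matrix.cons_val_zero, Matrix.cons_val_one,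
        Matrix.cons_val_fin_one, Matrix.empty_val', Fin.zero_eta, Fin.mk_one, Fin.isValue, map_add, map_sub, map_neg, him,
        hq.im_one, zero_add, zero_sub]
  rw [toSp_adelicInr_apply_reindexW_sumElim F E c hcδ hδ hd N e hV hW2 ⟨_, hA⟩ _ _ hP hQ x₁ x₂ y₁ y₂]
  congr 1
  refine Prod.ext ?_ ?_
  · refine funext fun s => ?_
    rcases s with j | j <;>
      simp only [Sum.elim_inl, Sum.elim_inr, Matrix.of_apply, Matrix.cons_val', Matrix.cons_val_zero, Matrix.cons_val_one,
        Matrix.cons_val_fin_one, Matrix.empty_val', Pi.add_apply, Pi.sub_apply, Pi.smul_apply, smul_eq_mul] <;>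
      ring
  · refine funext fun s => ?_
    rcases s with j | j <;>
      simp only [Sum.elim_inl, Sum.elim_inr, Matrix.of_apply, Matrix.cons_val', Matrix.cons_val_zero, Matrix.cons_val_one,
        Matrix.cons_val_fin_one, Matrix.empty_val', Pi.add_apply, Pi.sub_apply, Pi.smul_apply, smul_eq_mul] <;>
      ring

end Action

end UnitaryGroup

/-! ## §4 RED-B transported to the diagonal carrier `U_D` -/

namespace DoubledUnitary.RankOneReduction

section BorelDiag

variable (F E : Type) [Field F] [NumberField F] [Field E] [NumberField E] [Algebra F E] (c : E ≃ₐ[F] E)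
  (TW : Matrix (Fin 1) (Fin 1) F)

omit [NumberField F] in
/-- An upper unipotent `n(ι x)` with an `E`-RATIONAL parameter is an `E`-rational matrix. [cite: GelbartRogawski1991, §1] -/
theorem upper_mem_range_map {nx : GL (Fin 2) (AdeleRing (𝓞 E) E)} {x : E}
    (hn : (nx : Matrix (Fin 2) (Fin 2) (AdeleRing (𝓞 E) E)) = !![1, algebraMap E (AdeleRing (𝓞 E) E) x; 0, 1]) :
    nx ∈ (Matrix.GeneralLinearGroup.map (algebraMap E (AdeleRing (𝓞 E) E))).range := by
  obtain ⟨n₀, hn₀, -⟩ := exists_upper (S := E) x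
  refine ⟨n₀, Units.ext ?_⟩
  rw [hn]
  change (n₀ : Matrix (Fin 2) (Fin 2) E).map (algebraMap E (AdeleRing (𝓞 E) E)) = _
  rw [hn₀]
  ext i j
  fin_cases i <;> fin_cases j <;> simp

/-- **RED-B in the diagonal carrier `U_D = UnitaryGroup.adelic F E c (1+1) (T_W ⊕ −T_W)`.**  With the `E`-rational Cayley matrix `M`
(★ `exists_cayleyTwo`) and the compact sets `C_E ⊆ 𝕀_E`, `K_F ⊆ 𝔸_F` of ★ `exists_borel_factorisation`: every `b ∈ U_D` stabilising
`W^Δ` (`b₀₀ + b₀₁ = b₁₀ + b₁₁`) factors as `b = γ · (M n(δω) M⁻¹) · (M d(c·z_E r) M⁻¹)` with `γ = M (d(q) n(δξ)) M⁻¹ ∈ U_D` an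
`E`-RATIONAL matrix, `ω ∈ K_F`, `c ∈ C_E`, `r > 0`, all three factors in `U_D`. [cite: Weil1965, n° 50 pp. 72–74] [cite: HarrisKudlaSweet1996, §1 (1.11)] -/
theorem exists_borel_factorisation_diag [IsGalois F E] (h2 : ∀ σ : E ≃ₐ[F] E, σ = 1 ∨ σ = c) (δ : Eˣ)
    (hcδ : c (δ : E) = -(δ : E)) {d : F} (hd : (δ : E) * δ = algebraMap F E d) (hTW : TW 0 0 ≠ 0) :
    ∃ M : GL (Fin 2) (AdeleRing (𝓞 E) E),
      M ∈ (Matrix.GeneralLinearGroup.map (algebraMap E (AdeleRing (𝓞 E) E))).range ∧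
      (M : Matrix (Fin 2) (Fin 2) (AdeleRing (𝓞 E) E)) =
        !![1, algebraMap E (AdeleRing (𝓞 E) E) (algebraMap F E (2 * TW 0 0)⁻¹);
          1, -algebraMap E (AdeleRing (𝓞 E) E) (algebraMap F E (2 * TW 0 0)⁻¹)] ∧
      ∃ CE : Set (AdeleRing (𝓞 E) E)ˣ, IsCompact CE ∧ ∃ KF : Set (AdeleRing (𝓞 F) F), IsCompact KF ∧
      ∀ b : GL (Fin (1 + 1)) (AdeleRing (𝓞 E) E),
        b ∈ UnitaryGroup.adelic F E c (1 + 1)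
            ((Matrix.reindex finSumFinEquiv finSumFinEquiv (Matrix.fromBlocks TW 0 0 (-TW))).map (algebraMap F E)) →
        (b : Matrix (Fin (1 + 1)) (Fin (1 + 1)) (AdeleRing (𝓞 E) E)) 0 0 +
            (b : Matrix (Fin (1 + 1)) (Fin (1 + 1)) (AdeleRing (𝓞 E) E)) 0 1 =
          (b : Matrix (Fin (1 + 1)) (Fin (1 + 1)) (AdeleRing (𝓞 E) E)) 1 0 +
            (b : Matrix (Fin (1 + 1)) (Fin (1 + 1)) (AdeleRing (𝓞 E) E)) 1 1 →
        ∃ q : Eˣ, ∃ ξ : F, ∃ ω ∈ KF, ∃ cc ∈ CE, ∃ r : ℝ≥0ˣ, ∃ nξ nω : GL (Fin 2) (AdeleRing (𝓞 E) E),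
          (nξ : Matrix (Fin 2) (Fin 2) (AdeleRing (𝓞 E) E)) =
              !![1, algebraMap E (AdeleRing (𝓞 E) E) ((δ : E) * algebraMap F E ξ); 0, 1] ∧
          (nω : Matrix (Fin 2) (Fin 2) (AdeleRing (𝓞 E) E)) =
              !![1, algebraMap E (AdeleRing (𝓞 E) E) (δ : E) * AdeleRing.baseChange F E ω; 0, 1] ∧
          M * nω * M⁻¹ ∈ UnitaryGroup.adelic F E c (1 + 1)
              ((Matrix.reindex finSumFinEquiv finSumFinEquiv (Matrix.fromBlocks TW 0 0 (-TW))).map (algebraMap F E)) ∧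
          M * (glDiagonal 2 (AdeleRing (𝓞 E) E)
                ![Units.map (algebraMap E (AdeleRing (𝓞 E) E) : E →* AdeleRing (𝓞 E) E) q,
                  (Units.map (UnitaryGroup.conjAdele F E c : AdeleRing (𝓞 E) E →* AdeleRing (𝓞 E) E)
                    (Units.map (algebraMap E (AdeleRing (𝓞 E) E) : E →* AdeleRing (𝓞 E) E) q))⁻¹] * nξ) * M⁻¹ ∈
            UnitaryGroup.adelic F E c (1 + 1)
              ((Matrix.reindex finSumFinEquiv finSumFinEquiv (Matrix.fromBlocks TW 0 0 (-TW))).map (algebraMap F E)) ∧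
          M * (glDiagonal 2 (AdeleRing (𝓞 E) E)
                ![Units.map (algebraMap E (AdeleRing (𝓞 E) E) : E →* AdeleRing (𝓞 E) E) q,
                  (Units.map (UnitaryGroup.conjAdele F E c : AdeleRing (𝓞 E) E →* AdeleRing (𝓞 E) E)
                    (Units.map (algebraMap E (AdeleRing (𝓞 E) E) : E →* AdeleRing (𝓞 E) E) q))⁻¹] * nξ) * M⁻¹ ∈
            (Matrix.GeneralLinearGroup.map (algebraMap E (AdeleRing (𝓞 E) E))).range ∧
          M * glDiagonal 2 (AdeleRing (𝓞 E) E)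
                ![cc * posRealIdele E r,
                  (Units.map (UnitaryGroup.conjAdele F E c : AdeleRing (𝓞 E) E →* AdeleRing (𝓞 E) E) (cc * posRealIdele E r))⁻¹] * M⁻¹ ∈
            UnitaryGroup.adelic F E c (1 + 1)
              ((Matrix.reindex finSumFinEquiv finSumFinEquiv (Matrix.fromBlocks TW 0 0 (-TW))).map (algebraMap F E)) ∧
          b = (M * (glDiagonal 2 (AdeleRing (𝓞 E) E)
                ![Units.map (algebraMap E (AdeleRing (𝓞 E) E) : E →* AdeleRing (𝓞 E) E) q,
                  (Units.map (UnitaryGroup.conjAdele F E c : AdeleRing (𝓞 E) E →* AdeleRing (𝓞 E) E)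
                    (Units.map (algebraMap E (AdeleRing (𝓞 E) E) : E →* AdeleRing (𝓞 E) E) q))⁻¹] * nξ) * M⁻¹) *
              (M * nω * M⁻¹) *
              (M * glDiagonal 2 (AdeleRing (𝓞 E) E)
                ![cc * posRealIdele E r,
                  (Units.map (UnitaryGroup.conjAdele F E c : AdeleRing (𝓞 E) E →* AdeleRing (𝓞 E) E) (cc * posRealIdele E r))⁻¹] * M⁻¹) := by
  obtain ⟨M, hMrat, hM⟩ := exists_cayleyTwo F E TW hTW
  obtain ⟨CE, hCEc, KF, hKFc, hfac⟩ := exists_borel_factorisation F E c h2 δ hcδ hd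
  have hiff := fun g => conj_mem_adelic_doubledLine_iff F E c TW hTW hM g
  have hht : algebraMap E (AdeleRing (𝓞 E) E) (algebraMap F E (2 * TW 0 0)⁻¹) *
      (algebraMap E (AdeleRing (𝓞 E) E) (algebraMap F E (TW 0 0)) + algebraMap E (AdeleRing (𝓞 E) E) (algebraMap F E (TW 0 0))) = 1 := by
    rw [← map_add, ← map_add, ← map_mul, ← map_mul, ← two_mul, inv_mul_cancel₀ (mul_ne_zero two_ne_zero hTW), map_one, map_one]
  have hττ := conjAdele_conjAdele F E c h2
  refine ⟨M, hMrat, hM, CE, hCEc, KF, hKFc, fun b hb hrow => ?_⟩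
  -- transport `b` to the split model
  set b' : GL (Fin 2) (AdeleRing (𝓞 E) E) := M⁻¹ * b * M with hb'
  have hbb' : M * b' * M⁻¹ = b := by rw [hb']; group
  have hb'U : b' ∈ unitaryGroupOfForm (UnitaryGroup.conjAdele F E c)
      (!![(0 : AdeleRing (𝓞 E) E), 1; 1, 0] : Matrix (Fin 2) (Fin 2) (AdeleRing (𝓞 E) E)) := by
    rw [← hiff b', hbb']
    exact hb
  have hb'10 : (b' : Matrix (Fin 2) (Fin 2) (AdeleRing (𝓞 E) E)) 1 0 = 0 := by
    rw [hb', conj_apply_one_zero hM hht b]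
    have hrow' : ((b : Matrix (Fin 2) (Fin 2) (AdeleRing (𝓞 E) E)) 0 0 + (b : Matrix (Fin 2) (Fin 2) (AdeleRing (𝓞 E) E)) 0 1) -
        ((b : Matrix (Fin 2) (Fin 2) (AdeleRing (𝓞 E) E)) 1 0 + (b : Matrix (Fin 2) (Fin 2) (AdeleRing (𝓞 E) E)) 1 1) = 0 :=
      sub_eq_zero.2 hrow
    rw [hrow', mul_zero]
  obtain ⟨q, ξ, ω, hω, cc, hcc, r, nξ, nω, hnξ, hnω, hnξU, hnωU, hfac'⟩ := hfac b' hb'U hb'10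
  have hdU : ∀ u : (AdeleRing (𝓞 E) E)ˣ, glDiagonal 2 (AdeleRing (𝓞 E) E)
      ![u, (Units.map (UnitaryGroup.conjAdele F E c : AdeleRing (𝓞 E) E →* AdeleRing (𝓞 E) E) u)⁻¹] ∈
      unitaryGroupOfForm (UnitaryGroup.conjAdele F E c)
        (!![(0 : AdeleRing (𝓞 E) E), 1; 1, 0] : Matrix (Fin 2) (Fin 2) (AdeleRing (𝓞 E) E)) :=
    fun u => diag_mem_unitaryGroupOfForm (UnitaryGroup.conjAdele F E c) hττ u
  refine ⟨q, ξ, ω, hω, cc, hcc, r, nξ, nω, hnξ, hnω, (hiff _).2 hnωU, (hiff _).2 (mul_mem (hdU _) hnξU), ?_, (hiff _).2 (hdU _), ?_⟩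
  · -- rationality of `γ = M (d(q) n(δξ)) M⁻¹`
    refine mul_mem (mul_mem hMrat (mul_mem ?_ (upper_mem_range_map E hnξ))) (inv_mem hMrat)
    exact ⟨_, (diag_principal_eq_map F E c q).symm⟩
  · rw [← hbb', hfac']
    group

end BorelDiag

end DoubledUnitary.RankOneReduction

end Literature.NumberTheory.Automorphic

end
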